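import Literature.NumberTheory.EllipticCurves.PeriodRationalityCorrectedProofs
import Literature.NumberTheory.EllipticCurves.ModularCurveProofs
import Literature.NumberTheory.EllipticCurves.NewformsCoeffFieldHolds
import Literature.NumberTheory.Transcendental.LindemannWeierstrassProofs
import HarnessLib

/-!
# Paşol–Popa, Prop. 5.11(b) as printed is false: the refutation of
# `PasolPopa2013_criticalValuesRationality` by `f = Δ`

The named fact `PasolPopa2013_criticalValuesRationality` (`PeriodRationality.lean`) transcribes
[PP, Prop. 5.11(b)] with the printed normalisation `ω⁺ \overline{ω⁻} / (i (2π)^{k-1} (f,f)) ∈ K_f`.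
The proof in [PP] (Thm. 3.3, `3 C_k (f,f) = {ρ_f⁺, \overline{ρ_f⁻}}`, `C_k = -(2i)^{k-1}`, with the periods
`ρ_f` built from the completed values `Λ(n,f) = (2π)^{-n}Γ(n)L(n,f)`) gives `2^{k-1}` instead; that corrected
statement is `PasolPopa2013_criticalValuesRationalityCorrected`, PROVED in
`PeriodRationalityCorrectedProofs.lean`. This file proves that the printed normalisation is actually
false, i.e. `¬ PasolPopa2013_criticalValuesRationality` (`not_PasolPopa2013_criticalValuesRationality`):

* `exists_isNewform0_coe_eq_discriminant` — Mathlib's discriminant `Δ` is a newform of weight `12` on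
  `Γ₀(1)` in the sense of the tree's `IsNewform0` (`Γ₀(1) = SL₂(ℤ)`, `coe_gamma0_one`; there are no
  proper divisors of the level, so the new subspace is everything; `dim S₁₂(SL₂(ℤ)) = 1`
  (Mathlib `CuspForm.exists_smul_discriminant_of_weight_eq_twelve`), so `Δ` is an eigenvector of every
  endomorphism, in particular of the `T_p`; `a₁(Δ) = 1`, Mathlib `discriminant_qExpansion_coeff_one`).
* `completedLValue_ne_zero_of_forall_apply_ne_zero` — if a cusp form with real Fourier coefficients does
  not vanish on the imaginary axis then none of its Mellin moments `Λ(m, f) = ∫₀^∞ f(it) t^{m-1} dt`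
  vanishes (`f(it)` is real, of constant sign by the intermediate value theorem). For `Δ` (nowhere
  vanishing, Mathlib `ModularForm.discriminant_ne_zero`) this gives `Λ(1,Δ) ≠ 0 ≠ Λ(2,Δ)`.
* `not_PasolPopa2013_criticalValuesRationality` — for `f = Δ` both the printed statement and the corrected
  (proved) one provide periods with `iΛ(1,Δ)/ω⁺`, `i²Λ(2,Δ)/ω⁻ ∈ K_Δ`; since these critical values are
  nonzero the two pairs of periods agree up to `K_Δ^×` (and `K_Δ ⊆ ℝ`), so the quotient of the two
  (b)-clauses, `(2π)^{11}/2^{11} = π^{11}`, lies in the number field `K_Δ`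
  (`IsNewform0.finiteDimensional_coeffField_holds`) — contradicting Lindemann's theorem
  (`Literature.NumberTheory.Transcendental.transcendental_pi_holds`, proved in the tree).

Numerically (Zagier, *Periods of modular forms and Jacobi theta functions*, §1, level one):
`Λ(1,Δ)Λ(2,Δ)/(Δ,Δ) ∈ 2¹³·3²/(5·691) · ℚ^×`-normalisation, i.e. rational, as the corrected statement says.

## References
* [PP] V. Paşol, A. A. Popa, *Modular forms and period polynomials*, Proc. LMS 107 (2013) 713–743,
  arXiv:1202.5802: Prop. 5.11(b), Cor. 5.12, Thm. 3.3. [cite: PasolPopa2013]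
* F. Lindemann, *Über die Zahl π*, Math. Ann. 20 (1882) (tree: `LindemannWeierstrassProofs`).
-/

noncomputable section

open MeasureTheory Set Filter Complex
open scoped ComplexConjugate MatrixGroups ModularForm
open UpperHalfPlane hiding I

namespace Literature.NumberTheory.EllipticCurves.ModularForms

open CongruenceSubgroup

/-! ### `Δ` is a newform of weight `12` on `Γ₀(1)` -/

section LevelOne

/-- Transport of Mathlib's level-one, weight-`12` results (stated for `𝒮ℒ` and the literal weight `12`)
to any subgroup equal to `𝒮ℒ` and any weight equal to `12`. [folklore] -/
private theorem levelOne_aux {Γ : Subgroup (GL (Fin 2) ℝ)} [Γ.HasDetOne] {k : ℤ} (hΓ : Γ = 𝒮ℒ)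
    (hk : k = 12) :
    ∃ Δ₀ : CuspForm Γ k, (⇑Δ₀ : ℍ → ℂ) = ModularForm.discriminant ∧
      ∀ g : CuspForm Γ k, ∃ c : ℂ, c • Δ₀ = g := by
  subst hΓ hk
  exact ⟨CuspForm.discriminant, rfl, CuspForm.exists_smul_discriminant_of_weight_eq_twelve⟩

/-- **`Δ ∈ S₁₂(Γ₀(1))` is a newform** in the sense of `IsNewform0`: it lies in the new subspace (the
level `1` has no proper divisors), it is an eigenform of every Hecke operator `T_p` because
`S₁₂(SL₂(ℤ)) = ℂΔ` is one-dimensional (Mathlib `CuspForm.exists_smul_discriminant_of_weight_eq_twelve`),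
and `a₁(Δ) = 1` (Mathlib `ModularForm.discriminant_qExpansion_coeff_one`). The weight is any `k`
provably equal to `12` (e.g. the literal `12`, or the form `10 + 2` used by the Mellin lemmas of
`PeriodRationalityProofs`). [folklore] -/
theorem exists_isNewform0_coe_eq_discriminant {k : ℤ} (hk : k = 12) :
    ∃ f : CuspForm (Gamma0 1) k, (⇑f : ℍ → ℂ) = ModularForm.discriminant ∧ IsNewform0 f := by
  obtain ⟨Δ₀, hcoe, hspan⟩ := levelOne_aux (Γ := Gamma0 1) coe_gamma0_one hk
  refine ⟨Δ₀, hcoe, ?_, ?_, ?_⟩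
  · -- the new subspace at level `1` is everything: `DegeneracyIndex 1` is empty
    rw [newSubspace0, Submodule.mem_iInf]
    intro Md
    exact absurd Md.2.1 (by simp)
  · -- eigenform: every endomorphism of the line `ℂΔ` acts on `Δ` by a scalar
    intro p hp
    exact (hspan _).imp fun c hc ↦ hc.symm
  · -- normalised
    show (qExpansion 1 ⇑Δ₀).coeff 1 = 1
    rw [hcoe]
    exact ModularForm.discriminant_qExpansion_coeff_one

end LevelOne

/-! ### Nonvanishing of the Mellin moments of a real form without zeros on the imaginary axis -/

section Nonvanishing

variable {N : ℕ} [NeZero N] {n : ℕ}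

/-- If a cusp form `f ∈ S_{n+2}(Γ₀(N))` with real Fourier coefficients has no zero on the imaginary
axis, then `Λ(m, f) = ∫₀^∞ f(it) t^{m-1} dt ≠ 0` for every `m`: `t ↦ f(it)` is real
(`im_apply_ofComplex_mul_I_eq_zero`), continuous and nowhere zero on `(0, ∞)`, hence of constant sign
(intermediate value theorem), and the integral of a continuous integrable function of constant strict
sign is nonzero. [folklore] -/
theorem completedLValue_ne_zero_of_forall_apply_ne_zero (f : CuspForm (Gamma0 N) (n + 2))
    (hf : HasRealCoefficients f) (h0 : ∀ t : ℝ, 0 < t → f (ofComplex ((t : ℂ) * I)) ≠ 0) (m : ℕ) :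
    completedLValue f m ≠ 0 := by
  set g : ℝ → ℝ := fun t ↦ (f (ofComplex ((t : ℂ) * I))).re with hg
  have hg_cont : ContinuousOn g (Ioi 0) :=
    Complex.continuous_re.comp_continuousOn (continuousOn_apply_imag f)
  have hg_ne : ∀ t : ℝ, 0 < t → g t ≠ 0 := by
    intro t ht hgt
    refine h0 t ht (Complex.ext ?_ ?_)
    · simpa [hg] using hgt
    · simpa using im_apply_ofComplex_mul_I_eq_zero f hf ht
  -- constant sign on `(0, ∞)`
  have hsign : ∀ t : ℝ, 0 < t → 0 < g 1 * g t := by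
    intro t ht
    by_contra hle
    push Not at hle
    rcases mul_nonpos_iff.mp hle with ⟨h1, h2⟩ | ⟨h1, h2⟩
    · obtain ⟨c, hc, hgc⟩ := isPreconnected_Ioi.intermediate_value (show t ∈ Ioi (0 : ℝ) from ht)
        (Set.mem_Ioi.mpr one_pos : (1 : ℝ) ∈ Ioi (0 : ℝ)) hg_cont ⟨h2, h1⟩
      exact hg_ne c hc hgc
    · obtain ⟨c, hc, hgc⟩ := isPreconnected_Ioi.intermediate_value
        (Set.mem_Ioi.mpr one_pos : (1 : ℝ) ∈ Ioi (0 : ℝ)) (show t ∈ Ioi (0 : ℝ) from ht) hg_cont ⟨h1, h2⟩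
      exact hg_ne c hc hgc
  -- the real part of `Λ(m, f)` is the real Mellin moment of `g`
  have hint := integrableOn_mellin f (m - 1)
  have hre : (completedLValue f m).re = ∫ t in Ioi (0 : ℝ), t ^ (m - 1) * g t := by
    have h := integral_re hint
    simp only [RCLike.re_to_complex] at h
    rw [completedLValue, ← h]
    refine setIntegral_congr_fun measurableSet_Ioi fun t _ ↦ ?_
    rw [← Complex.ofReal_pow, Complex.re_ofReal_mul]
  have hintg : IntegrableOn (fun t : ℝ ↦ t ^ (m - 1) * g t) (Ioi 0) := by
    have h := hint.re
    refine IntegrableOn.congr_fun h (fun t _ ↦ ?_) measurableSet_Ioi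
    simp only [RCLike.re_to_complex]
    rw [← Complex.ofReal_pow, Complex.re_ofReal_mul]
  have hpos : 0 < g 1 * (completedLValue f m).re := by
    rw [hre, ← integral_const_mul]
    refine (setIntegral_pos_iff_support_of_nonneg_ae ?_ (hintg.const_mul (g 1))).mpr ?_
    · rw [EventuallyLE, ae_restrict_iff' measurableSet_Ioi]
      refine Eventually.of_forall fun t ht ↦ ?_
      have h1 : 0 < t ^ (m - 1) := pow_pos ht _
      have h2 := hsign t ht
      simp only [Pi.zero_apply]
      nlinarith [mul_pos h1 h2]
    · have hsupp : Ioi (0 : ℝ) ⊆ Function.support (fun t : ℝ ↦ g 1 * (t ^ (m - 1) * g t)) ∩ Ioi 0 := by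
        intro t ht
        refine ⟨?_, ht⟩
        rw [Function.mem_support]
        exact mul_ne_zero (hg_ne 1 one_pos) (mul_ne_zero (pow_ne_zero _ (ne_of_gt ht)) (hg_ne t ht))
      refine lt_of_lt_of_le ?_ (measure_mono hsupp)
      simp
  have hne : (completedLValue f m).re ≠ 0 := by
    intro h
    rw [h, mul_zero] at hpos
    exact lt_irrefl _ hpos
  intro h
  exact hne (by rw [h, Complex.zero_re])

end Nonvanishing

/-! ### Two normalisations of the same periods differ by an element of `K_f` -/

section Algebra

/-- The bookkeeping behind the refutation: if `A/ω⁺, B/ω⁻, ω⁺\overline{ω⁻}/(iXP)` and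
`A/ω'⁺, B/ω'⁻, ω'⁺\overline{ω'⁻}/(iYP)` all lie in a real subfield `K ⊆ ℂ`, with `A, B, P, X, Y` and
the periods nonzero, then `X/Y ∈ K` (the two period pairs agree up to `K^×`). [folklore] -/
private theorem div_mem_of_two_normalisations (K : IntermediateField ℚ ℂ) (hK : ∀ z ∈ K, conj z = z)
    {A B P X Y ωp ωm ωp' ωm' : ℂ} (hA : A ≠ 0) (hB : B ≠ 0) (hP : P ≠ 0) (hX : X ≠ 0) (hY : Y ≠ 0)
    (hp : ωp ≠ 0) (hm : ωm ≠ 0) (hp' : ωp' ≠ 0) (hm' : ωm' ≠ 0)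
    (ha : A / ωp ∈ K) (hb : B / ωm ∈ K) (hc : ωp * conj ωm / (I * X * P) ∈ K)
    (ha' : A / ωp' ∈ K) (hb' : B / ωm' ∈ K) (hc' : ωp' * conj ωm' / (I * Y * P) ∈ K) :
    X / Y ∈ K := by
  have e1 : A / ωp * ωp = A / ωp' * ωp' := by rw [div_mul_cancel₀ A hp, div_mul_cancel₀ A hp']
  have e2 : B / ωm * conj ωm = B / ωm' * conj ωm' := by
    rw [← hK _ hb, ← hK _ hb', ← map_mul, ← map_mul, div_mul_cancel₀ B hm, div_mul_cancel₀ B hm']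
  have hcm : conj ωm ≠ 0 := by simpa using hm
  have hcm' : conj ωm' ≠ 0 := by simpa using hm'
  have h3 : A / ωp * (B / ωm) * (ωp * conj ωm / (I * X * P)) * X =
      (A / ωp * ωp) * (B / ωm * conj ωm) / (I * P) := by
    field_simp
  have h4 : A / ωp' * (B / ωm') * (ωp' * conj ωm' / (I * Y * P)) * Y =
      (A / ωp' * ωp') * (B / ωm' * conj ωm') / (I * P) := by
    field_simp
  have habc : A / ωp * (B / ωm) * (ωp * conj ωm / (I * X * P)) ≠ 0 :=
    mul_ne_zero (mul_ne_zero (div_ne_zero hA hp) (div_ne_zero hB hm))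
      (div_ne_zero (mul_ne_zero hp hcm) (mul_ne_zero (mul_ne_zero I_ne_zero hX) hP))
  have key : X / Y = A / ωp' * (B / ωm') * (ωp' * conj ωm' / (I * Y * P)) /
      (A / ωp * (B / ωm) * (ωp * conj ωm / (I * X * P))) := by
    rw [div_eq_div_iff hY habc]
    calc X * (A / ωp * (B / ωm) * (ωp * conj ωm / (I * X * P)))
        = A / ωp * (B / ωm) * (ωp * conj ωm / (I * X * P)) * X := by ring
      _ = (A / ωp * ωp) * (B / ωm * conj ωm) / (I * P) := h3
      _ = (A / ωp' * ωp') * (B / ωm' * conj ωm') / (I * P) := by rw [e1, e2]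
      _ = A / ωp' * (B / ωm') * (ωp' * conj ωm' / (I * Y * P)) * Y := h4.symm
  rw [key]
  exact div_mem (mul_mem (mul_mem ha' hb') hc') (mul_mem (mul_mem ha hb) hc)

end Algebra

/-! ### The refutation -/

section Refutation

/-- **Paşol–Popa Prop. 5.11(b) with the printed `(2π)^{k-1}` is false; `f = Δ` is a counterexample.**
For `Δ ∈ S₁₂(Γ₀(1))` (`exists_isNewform0_coe_eq_discriminant`) the critical values `Λ(1,Δ)`, `Λ(2,Δ)` are
nonzero (`completedLValue_ne_zero_of_forall_apply_ne_zero`, Mathlib `ModularForm.discriminant_ne_zero`),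
so any two pairs of periods satisfying Cor. 5.12 agree up to `K_Δ^×`; comparing clause (b) of the
printed statement with clause (b) of the corrected, proved statement
`PasolPopa2013_criticalValuesRationalityCorrected_holds` ([PP] Thm. 3.3) puts `(2π)^{11}/2^{11} = π^{11}`
in the number field `K_Δ` (`IsNewform0.finiteDimensional_coeffField_holds`), contradicting the
transcendence of `π` (`Literature.NumberTheory.Transcendental.transcendental_pi_holds`). [cite: PasolPopa2013, Prop. 5.11(b), Cor. 5.12 and Thm. 3.3 (misprint `(2π)^{k-1}` for `2^{k-1}`)] -/
theorem not_PasolPopa2013_criticalValuesRationality : ¬ PasolPopa2013_criticalValuesRationality := by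
  intro h
  obtain ⟨f, hcoe, hf⟩ :=
    exists_isNewform0_coe_eq_discriminant (k := ((10 : ℕ) : ℤ) + 2) (by norm_num)
  obtain ⟨ωp, ωm, hp, hm, hval, hb, -, -⟩ := h 1 _ f hf
  obtain ⟨ωp', ωm', hp', hm', hval', hb', -, -⟩ :=
    PasolPopa2013_criticalValuesRationalityCorrected_holds 1 _ f hf
  have heven : Even ((((10 : ℕ) : ℤ)) + 2) := ⟨6, by norm_num⟩
  have hpar1 : ((1 : ℕ) : ℤ).negOnePow = ((((10 : ℕ) : ℤ)) + 2 - 1).negOnePow := by decide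
  have hpar2 : ((2 : ℕ) : ℤ).negOnePow = -((((10 : ℕ) : ℤ)) + 2 - 1).negOnePow := by decide
  have ha := (hval 1 one_pos (by norm_num)).1 hpar1
  have hbm := (hval 2 two_pos (by norm_num)).2 hpar2
  have ha' := (hval' 1 one_pos (by norm_num)).1 hpar1
  have hbm' := (hval' 2 two_pos (by norm_num)).2 hpar2
  replace hb := hb heven
  replace hb' := hb' heven
  -- the inputs are nonzero
  have hreal : HasRealCoefficients f := hf.cuspCoeff_im_eq_zero
  have h0 : ∀ t : ℝ, 0 < t → f (ofComplex ((t : ℂ) * I)) ≠ 0 := fun t _ ↦ by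
    rw [hcoe]
    exact ModularForm.discriminant_ne_zero _
  have hΛ1 : I ^ 1 * completedLValue f 1 ≠ 0 :=
    mul_ne_zero (pow_ne_zero _ I_ne_zero)
      (completedLValue_ne_zero_of_forall_apply_ne_zero f hreal h0 1)
  have hΛ2 : I ^ 2 * completedLValue f 2 ≠ 0 :=
    mul_ne_zero (pow_ne_zero _ I_ne_zero)
      (completedLValue_ne_zero_of_forall_apply_ne_zero f hreal h0 2)
  have hP : peterssonProduct (Gamma0 1) (((10 : ℕ) : ℤ) + 2) f f ≠ 0 := by
    intro hP0
    have hpos := peterssonProduct_self_pos_holds (Gamma0 1) (((10 : ℕ) : ℤ) + 2)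
      (IsNormalized.ne_zero_gamma0 hf.2.2)
    rw [hP0, Complex.zero_re] at hpos
    exact lt_irrefl _ hpos
  have hK : ∀ z ∈ coeffField f, conj z = z := fun z hz ↦
    Complex.conj_eq_iff_im.mpr (hf.im_eq_zero_of_mem_coeffField hz)
  have h2pi : (2 * Real.pi : ℂ) ≠ 0 :=
    mul_ne_zero two_ne_zero (Complex.ofReal_ne_zero.mpr Real.pi_ne_zero)
  have hX : (2 * Real.pi : ℂ) ^ ((((10 : ℕ) : ℤ)) + 2 - 1) ≠ 0 := zpow_ne_zero _ h2pi
  have hY : (2 : ℂ) ^ ((((10 : ℕ) : ℤ)) + 2 - 1) ≠ 0 := zpow_ne_zero _ two_ne_zero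
  have hmem := div_mem_of_two_normalisations (coeffField f) hK hΛ1 hΛ2 hP hX hY hp hm hp' hm'
    ha hbm hb ha' hbm' hb'
  -- `X / Y = π ^ 11`
  have hXY : (2 * Real.pi : ℂ) ^ ((((10 : ℕ) : ℤ)) + 2 - 1) / (2 : ℂ) ^ ((((10 : ℕ) : ℤ)) + 2 - 1) =
      (Real.pi : ℂ) ^ 11 := by
    rw [show (((10 : ℕ) : ℤ)) + 2 - 1 = ((11 : ℕ) : ℤ) by norm_num, zpow_natCast, zpow_natCast,
      ← div_pow, mul_div_cancel_left₀ _ (two_ne_zero : (2 : ℂ) ≠ 0)]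
  rw [hXY] at hmem
  -- `π ^ 11 ∈ K_Δ`, a number field: contradiction with Lindemann
  haveI : FiniteDimensional ℚ (coeffField f) := IsNewform0.finiteDimensional_coeffField_holds hf
  have halg : IsAlgebraic ℚ ((Real.pi : ℂ) ^ 11) :=
    IntermediateField.isAlgebraic_iff.mp
      (Algebra.IsAlgebraic.isAlgebraic (⟨_, hmem⟩ : coeffField f))
  have hpi : IsAlgebraic ℚ (Real.pi : ℂ) := halg.of_pow (by norm_num)
  rw [show (Real.pi : ℂ) = algebraMap ℝ ℂ Real.pi from rfl,
    isAlgebraic_algebraMap_iff Complex.ofReal_injective] at hpi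
  exact Literature.NumberTheory.Transcendental.transcendental_pi_holds hpi

end Refutation

/-! ### What holds instead for rational newforms (`K_f = ℚ`, e.g. `f = Δ`) -/

section Corollary

/-- **Corrected [PP] Prop. 5.11 (b),(c) / Cor. 5.12 for newforms with rational coefficients** (`K_f = ℚ`,
e.g. `f = Δ`, the case of route `DeltaPeriodAudit`). There are nonzero periods `ω⁺, ω⁻` with
`iⁿΛ(n,f) ∈ ℚ ω⁺` resp. `ℚ ω⁻` for the critical integers `0 < n < k` of the two parities (Cor. 5.12);
for even `k`, `ω⁺\overline{ω⁻} ∈ ℚ · i 2^{k-1}(f,f)` — the CORRECTED normalisation `2^{k-1}` of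
Prop. 5.11(b), not the misprinted `(2π)^{k-1}` (refuted above: `not_PasolPopa2013_criticalValuesRationality`);
and if `f` has real Fourier coefficients then `ω⁺ ∈ i^{k+1}ℝ`, `ω⁻ ∈ i^kℝ` (Prop. 5.11(c)).
This is the unconditional replacement of `PasolPopa2013_criticalValuesRationality.exists_rat_of_coeffField_eq_bot`
(whose hypothesis is the refuted fact). [cite: PasolPopa2013, Prop. 5.11 (b),(c), Cor. 5.12 and Thm. 3.3] -/
theorem PasolPopa2013_criticalValuesRationalityCorrected.exists_rat_of_coeffField_eq_bot {N : ℕ} [NeZero N]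
    {k : ℤ} {f : CuspForm (Gamma0 N) k} (hf : IsNewform0 f) (hK : coeffField f = ⊥) :
    ∃ ωp ωm : ℂ, ωp ≠ 0 ∧ ωm ≠ 0 ∧
      (∀ n : ℕ, 0 < n → (n : ℤ) < k → (n : ℤ).negOnePow = (k - 1).negOnePow →
        ∃ q : ℚ, I ^ n * completedLValue f n = q * ωp) ∧
      (∀ n : ℕ, 0 < n → (n : ℤ) < k → (n : ℤ).negOnePow = -(k - 1).negOnePow →
        ∃ q : ℚ, I ^ n * completedLValue f n = q * ωm) ∧
      (Even k → ∃ q : ℚ, ωp * conj ωm =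
        q * (I * (2 : ℂ) ^ (k - 1) * peterssonProduct (Gamma0 N) k f f)) ∧
      (HasRealCoefficients f → (∃ r : ℝ, ωp = I ^ (k + 1) * r) ∧ (∃ r : ℝ, ωm = I ^ k * r)) := by
  obtain ⟨ωp, ωm, hp, hm, hval, hb, -, hc⟩ :=
    PasolPopa2013_criticalValuesRationalityCorrected_holds N k f hf
  -- `x / d ∈ K_f = ℚ` with `d ≠ 0` unpacks to `x ∈ ℚ d`
  have hrat : ∀ {x d : ℂ}, d ≠ 0 → x / d ∈ coeffField f → ∃ q : ℚ, x = q * d := by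
    intro x d hd hx
    rw [hK, IntermediateField.mem_bot] at hx
    obtain ⟨q, hq⟩ := hx
    refine ⟨q, ?_⟩
    have : algebraMap ℚ ℂ q * d = x := by rw [hq, div_mul_cancel₀ _ hd]
    simpa using this.symm
  -- the corrected normalising constant `i 2^{k-1} (f,f)` is nonzero (`(f,f) > 0` for `f ≠ 0`)
  have hP : I * (2 : ℂ) ^ (k - 1) * peterssonProduct (Gamma0 N) k f f ≠ 0 := by
    refine mul_ne_zero (mul_ne_zero I_ne_zero (zpow_ne_zero _ two_ne_zero)) fun h0 ↦ ?_
    have hpos := peterssonProduct_self_pos_holds (Gamma0 N) k (IsNormalized.ne_zero_gamma0 hf.2.2)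
    rw [h0, Complex.zero_re] at hpos
    exact lt_irrefl _ hpos
  exact ⟨ωp, ωm, hp, hm, fun n hn hnk hpar ↦ hrat hp ((hval n hn hnk).1 hpar),
    fun n hn hnk hpar ↦ hrat hm ((hval n hn hnk).2 hpar), fun hk ↦ hrat hP (hb hk), hc⟩

end Corollary

end Literature.NumberTheory.EllipticCurves.ModularForms

end
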